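import Mathlib
import Summits.ValiantsHypothesis.ValiantsHypothesis.Theorems.FifoMatchingNNNotVPSupportFnPadding
import Summits.ValiantsHypothesis.ValiantsHypothesis.Theorems.FifoMatchingNNNotVPProgram
import Summits.ValiantsHypothesis.ValiantsHypothesis.Theorems.FifoMatchingNNNotVPCliqueProgramAccept
import Summits.ValiantsHypothesis.ValiantsHypothesis.Theorems.FifoMatchingNNNotVPCliqueProgramReject
import HarnessLib

/-!
# Route FifoMatching — crux `NNNotVP` (stmt-ValiantsHypothesis-11615), line `division_split`:
# stub A `stub_supportFnHard` — PROOF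

Assembly of the registered stub `stub_supportFnHard` of `Cruxes/NNNotVP/Lines/division_split.lean`
(objects `σ` / `NN` / `SuppFn` / `freeVars` = the line's vocabulary,
`Theorems/FifoMatchingNNNotVPDivisionSplitDefs.lean`): for every `k, c`, eventually in `n`, every
monotone (`ℝ≥0`) polynomial `g` with the support function of `NN_n` with `≤ (log₂ n + k)^k` freed
variables has monotone circuit complexity `> 2^{(log₂ n + c)^c}`.

Chain (all landed): stub A ⟸ (`supportFnHard_of_cliqueProjection_seq`, via the tree's PROVED
Alon–Boppana bound `cliqueSqrt_monotone_lowerBound`) a clique-like monotone projection of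
nest-free perfect-matching existence along a sequence ⟸ (`exists_programProjection`: every token
program is such a projection; token game `…TokenGame`, `…TokenGameMatching`, `…RoundStructure`)
a token program with a run on every `⌊√m⌋`-clique vector and none on any `(⌊√m⌋-1)`-colouring
vector ⟸ the CLIQUE TOKEN PROGRAM `cliqueLab` (`…CliqueProgramDefs`): `cliqueLab_run_cliqueVec`
(ACCEPT) and `cliqueLab_noRun_colorVec` (REJECT), transported from its lexicographic position
type `Pos k m` to `Fin N` along `Fintype.orderIsoFinOfCardEq`; size `n = k + R N ≤ m^{12}` for
`m ≥ 5` (`k = ⌊√m⌋`, `R = 5k - 4`, `N = #Pos k m = 2 k m (m+1)^3`).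

* `stub_supportFnHard` — the registered stub, by name and signature.

What this says: nest-free perfect-matching existence (equivalently shuffle-square recognition) is
CLIQUE-hard under polynomial monotone projections, hence needs monotone Boolean circuits of size
`2^{(log n)^{ω(1)}}` (in fact `2^{n^{Ω(1)}}`), and so does every monotone arithmetic circuit for a
polynomial with the support function of `NN_n` (stub A of the line).  Honest framing: ONE of the
three open stubs of line `division_split` is closed; stubs Z (`stub_zeroOneTransfer`) and B2
(`stub_spreadCofactorReduction`), the crux `NNNotVP` and `VP ≠ VNP` stay OPEN (NOT proved).
No definitions, no named facts.
-/

noncomputable section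

-- Sub = Summit single-conjunct layout: the duplicated namespace component is mandated by the tree.
set_option linter.dupNamespace false

namespace Summit.ValiantsHypothesis.ValiantsHypothesis.Theorems.FifoMatching.NNNotVP.DivisionSplit

open MvPolynomial Literature.Computability.AlgebraicComplexity
open Literature.Computability.Complexity
open scoped NNReal BigOperators Classical

/-- **Runs transport along an order isomorphism of the position space.**  For
`φ : Fin N ≃o Pos k m`, the Fin-level program `(lab0 i ∘ φ, cliqueLab j ∘ (φ × φ))` has a run on
`y` iff the clique program has one. [folklore] -/
theorem run_transport {k m R N : ℕ} (hR : 0 < R) (φ : Fin N ≃o Pos k m) (y : KEdge m → Bool) :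
    (∃ p : Fin R → Fin k → Fin N, (∀ j, StrictMono (p j)) ∧
        (∀ i, Sum.elim y id (lab0 i (φ (p ⟨0, hR⟩ i))) = true) ∧
        ∀ (j : Fin R) (h : j.val + 1 < R) (i : Fin k),
          Sum.elim y id (cliqueLab j (φ (p j i)) (φ (p ⟨j.val + 1, h⟩ i))) = true) ↔
      ∃ P : Fin R → Fin k → Pos k m, (∀ j, StrictMono (P j)) ∧
        (∀ i, Sum.elim y id (lab0 i (P ⟨0, hR⟩ i)) = true) ∧
        ∀ (j : Fin R) (h : j.val + 1 < R) (i : Fin k),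
          Sum.elim y id (cliqueLab j (P j i) (P ⟨j.val + 1, h⟩ i)) = true := by
  constructor
  · rintro ⟨p, hp, h0, hS⟩
    exact ⟨fun j i => φ (p j i), fun j => φ.strictMono.comp (hp j), h0, hS⟩
  · rintro ⟨P, hP, h0, hS⟩
    refine ⟨fun j i => φ.symm (P j i), fun j => φ.symm.strictMono.comp (hP j), ?_, ?_⟩
    · intro i; simpa only [OrderIso.apply_symm_apply] using h0 i
    · intro j h i; simpa only [OrderIso.apply_symm_apply] using hS j h i

/-- Size of the position space of the clique program. [folklore] -/
theorem card_pos (k m : ℕ) :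
    Fintype.card (Pos k m) = k * ((m + 1) * (2 * (m * ((m + 1) * (m + 1))))) := by
  simp only [Pos, regCard, Regs, Fintype.card_lex, Fintype.card_prod, Fintype.card_fin]

/-- **Stub A of line `division_split` (`stub_supportFnHard`), by name.**  For all `k c`,
eventually in `n`: every `g ∈ ℝ≥0[x]` with the support function of `NN_n` with a set `T` of
`≤ (log₂ n + k)^k` freed variables has monotone complexity `> 2^{(log₂ n + c)^c}`. [folklore] -/
theorem stub_supportFnHard :
    ∀ k c : ℕ, ∃ n₀ : ℕ, ∀ n ≥ n₀, ∀ T : Finset (σ n), T.card ≤ (Nat.log 2 n + k) ^ k →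
      ∀ g : MvPolynomial (σ n) ℝ≥0, (∀ A : Finset (σ n), SuppFn g A ↔ SuppFn (freeVars T (NN n)) A) →
        2 ^ ((Nat.log 2 n + c) ^ c) < complexity g := by
  apply supportFnHard_of_cliqueProjection_seq 12
  refine ⟨5, fun m hm => ?_⟩
  -- parameters of the clique program
  set k : ℕ := Nat.sqrt m with hk_def
  have hk : 1 ≤ k := Nat.le_sqrt.2 (by omega)
  have hkm : k ≤ m := Nat.sqrt_le_self m
  set R : ℕ := 5 * k - 4 with hR_def
  have hR : R + 4 = 5 * k := by omega
  have hR0 : 0 < R := by omega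
  set N : ℕ := Fintype.card (Pos k m) with hN_def
  let φ : Fin N ≃o Pos k m := Fintype.orderIsoFinOfCardEq (Pos k m) rfl
  -- the projection of the transported program
  obtain ⟨e, he⟩ := exists_programProjection (KEdge m) k R N hR0
    (fun i q => lab0 i (φ q)) (fun j q q' => cliqueLab j (φ q) (φ q'))
  refine ⟨k + R * N, by omega, ?_, e, ?_, ?_⟩
  · -- size `k + R N ≤ m ^ 12`
    have hm2 : 2 ≤ m := by omega
    have pm : ∀ {a b i j : ℕ}, a ≤ m ^ i → b ≤ m ^ j → a * b ≤ m ^ (i + j) :=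
      fun ha hb => by rw [pow_add]; exact Nat.mul_le_mul ha hb
    have h1 : k ≤ m ^ 1 := by rw [pow_one]; exact hkm
    have hm1 : m ≤ m ^ 1 := by rw [pow_one]
    have h2 : m + 1 ≤ m ^ 2 := by nlinarith
    have h3 : 2 ≤ m ^ 1 := by rw [pow_one]; exact hm2
    have hRle : R ≤ m ^ 2 := by nlinarith
    have hN : N ≤ m ^ 9 := by
      rw [hN_def, card_pos]
      have := pm h1 (pm h2 (pm h3 (pm hm1 (pm h2 h2))))
      simpa using this
    have hRN : R * N ≤ m ^ 11 := by simpa using pm hRle hN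
    have hpow : m ^ 11 ≤ m ^ 12 := Nat.pow_le_pow_right (by omega) (by omega)
    have hpow' : m ^ 1 ≤ m ^ 11 := Nat.pow_le_pow_right (by omega) (by omega)
    have : m ^ 12 = m * m ^ 11 := by rw [pow_succ, mul_comm]
    nlinarith
  · -- ACCEPT: clique vectors
    intro Z hZ
    rw [he (cliqueVec Z), run_transport hR0 φ]
    exact cliqueLab_run_cliqueVec hk hR Z hZ
  · -- REJECT: colouring vectors
    intro O
    rw [← Bool.not_eq_true, he (colorVec O), run_transport hR0 φ]
    rintro ⟨P, hP, h0, hS⟩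
    exact cliqueLab_noRun_colorVec hk hR (c := k - 1) (by omega) O P hP h0 hS

end Summit.ValiantsHypothesis.ValiantsHypothesis.Theorems.FifoMatching.NNNotVP.DivisionSplit

end
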